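import Summits.PneNP.PneNP.Theorems.ChebyshevTracialDesignSpectralNonTightnessWide
import Summits.PneNP.PneNP.Theorems.ChebyshevTracialDesignCrossingPin
import Summits.PneNP.PneNP.Theorems.ChebyshevTracialDesignLevelMarginals
import Literature.Combinatorics.AssociationSchemes.CutMatchingRestriction
import HarnessLib

/-!
# Cell pnp-psdrank, route `ChebyshevTracialDesign`: the CELLS of the `r = 1` rung — rectangle values through Rothvoß's measures,
# uniform marginals, crossing cells (brick 23b) and non-crossing cells in the reduced instance

Harmonic backbone of the crux `TracialDecayExp20` (stmt-PneNP-19878), brick 30 (prover g8; step S6 of the `r = 1` rung, MEMO-10 §3).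
Vocabulary: `W = levelWeight n t C w` the weight of a design `(C, w)` on the `t`-cuts, `μ_c(A × B) = |(A × B) ∩ Q_c|/|Q_c|` Rothvoß's
measures (`Literature.Barriers.PneNP.mu`), a partial matching `S` of its support `V` (a Kupavskii–Zakharov core), a pattern `π ⊆ V`, the cell
`A_π × B` with `A_π = {U ∈ A : U ∩ V = π}` and `B` a set of perfect matchings all containing `S`.
* §1 `sum_sum_levelWeight_eq_sum_mu` (`Σ_{A×B} W = Σ_c w_c μ_c(A×B)`), the uniform marginals `mu_le_col` (`μ_c(A×B) ≤ |B|/|PM_n|`) and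
  `mu_le_row` (`μ_c(A×B) ≤ |A_t|/C(n,t)`), hence `abs_sum_sum_levelWeight_le_col` (`|Σ_{A×B} W| ≤ (Σ_c|w_c|)·|B|/|PM_n|`, the remainder/junk bound);
* §2 `sum_eq_sum_patterns` (split `A` by the pattern `U ∩ V`);
* §3 **crossing cells** `abs_crossing_cell_le`: if an edge `{a,b} ⊆ V` of `S` crosses `π`, `|Σ_{A_π×B} W| ≤ B_v·√(P_{D−4}·μ(A_π)·ν(B))` (brick 23b
  `crossingPin_value_le`);
* §4 **non-crossing cells** `noncrossing_cell_eq` (`Σ_{A_π×B} W = Σ_c w_c·(|Q''_c|/|Q_c|)·μ''_c(Ã×B̃)` in `K_m`, `m = n − |V|`, lit `mu_cell_eq`),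
  `abs_noncrossing_cell_le` (`≤ β·Σ_c|w_c|·|Q''_c|/|Q_c|` once `μ''_c ≤ β`), and the pattern sum `sum_patterns_cellClass_le`
  (`Σ_{π ⊆ V} |cell_π ∩ Q_c|/|Q_c| ≤ |{M : S ⊆ M}|/|PM_n|`, uniform column marginal).
[cite: Rothvoss2017, §2 (PDF p. 6)] [cite: KupavskiiZakharov2022, §2 and Lemma 11]
Stature: support/instrument. WHAT THIS IS NOT: not the r = 1 rung (assembly in the next files), nothing on psd rank, no P-vs-NP content.
Supports stmt-PneNP-19878.
-/

set_option linter.dupNamespace false -- `Summit.PneNP.PneNP.…`: summit = sub-problem (D-0017)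

noncomputable section

namespace Summit.PneNP.PneNP.Theorems.ChebyshevTracialDesignRungCells

open Finset Literature.Barriers.PneNP Literature.Combinatorics.Optimization
open Literature.Combinatorics.SetFamily
open Literature.Combinatorics.SimpleGraph.CycleSpace
open Literature.Combinatorics.AssociationSchemes.CutMatchingRestriction
open Summit.PneNP.PneNP.Theorems.ChebyshevTracialDesignLevelMarginals
open Summit.PneNP.PneNP.Theorems.ChebyshevTracialDesignCrossingPin

variable {n : ℕ}

/-! ### §1 Rectangle values through Rothvoß's measures; uniform marginals -/

/-- The `t`-cuts of `K_n` (`t` odd) as odd sets: there are `C(n,t)` of them. [cite: Rothvoss2017, §2 (PDF p. 6)] -/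
theorem card_tcuts_eq_choose {t : ℕ} (ht : Odd t) :
    (univ.filter fun U : OddSet n => U.1.card = t).card = n.choose t := by
  have h : (univ.filter fun U : OddSet n => U.1.card = t).card = (powersetCard t (univ : Finset (Fin n))).card := by
    refine card_bij (fun U _ => U.1) (fun U hU => ?_) (fun U _ U' _ h => Subtype.ext h) (fun U hU => ?_)
    · simp only [mem_filter, mem_univ, true_and] at hU
      exact mem_powersetCard_univ.2 hU
    · have hUt := (mem_powersetCard.1 hU).2
      exact ⟨⟨U, hUt ▸ ht⟩, by simp [hUt], rfl⟩
  rw [h, card_powersetCard, card_univ, Fintype.card_fin]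

/-- **Rectangle value = design applied to Rothvoß's measures**: `Σ_{U∈A} Σ_{M∈B} W(U,M) = Σ_{c ∈ C} w_c · μ_c(A × B)`.
[cite: Rothvoss2017, §2 (PDF p. 6)] -/
theorem sum_sum_levelWeight_eq_sum_mu (t : ℕ) (C : Finset ℕ) (w : ℕ → ℝ) (A : Finset (OddSet n)) (B : Finset (PMatch n)) :
    ∑ U ∈ A, ∑ M ∈ B, levelWeight n t C w U M = ∑ c ∈ C, w c * mu n t c A B := by
  calc ∑ U ∈ A, ∑ M ∈ B, levelWeight n t C w U M
      = ∑ U ∈ A, ∑ M ∈ B, ∑ c ∈ C, (if (U, M) ∈ Qset n t c then w c / ((Qset n t c).card : ℝ) else 0) := rfl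
    _ = ∑ U ∈ A, ∑ c ∈ C, ∑ M ∈ B, (if (U, M) ∈ Qset n t c then w c / ((Qset n t c).card : ℝ) else 0) :=
        sum_congr rfl fun U _ => Finset.sum_comm
    _ = ∑ c ∈ C, ∑ U ∈ A, ∑ M ∈ B, (if (U, M) ∈ Qset n t c then w c / ((Qset n t c).card : ℝ) else 0) :=
        Finset.sum_comm
    _ = ∑ c ∈ C, w c * mu n t c A B := by
        refine sum_congr rfl fun c _ => ?_
        rw [mu, ← sum_product' (f := fun U M => if (U, M) ∈ Qset n t c then w c / ((Qset n t c).card : ℝ) else 0),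
          ← sum_filter, filter_mem_eq_inter, sum_const, nsmul_eq_mul]
        ring

/-- `μ_c(A × B) ≥ 0`. [cite: Rothvoss2017, §2 (PDF p. 6)] -/
theorem mu_nonneg (t c : ℕ) (A : Finset (OddSet n)) (B : Finset (PMatch n)) : 0 ≤ mu n t c A B := by
  unfold mu; positivity

/-- **Uniform column marginal**: `μ_c(A × B) ≤ |B|/|PM_n|`. [cite: Rothvoss2017, §2 (PDF p. 6)] -/
theorem mu_le_col (t c : ℕ) (A : Finset (OddSet n)) (B : Finset (PMatch n)) :
    mu n t c A B ≤ (B.card : ℝ) / Fintype.card (PMatch n) := by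
  classical
  rcases (Qset n t c).eq_empty_or_nonempty with hQ | ⟨q₀, hq₀⟩
  · rw [mu, hQ, inter_empty, card_empty, Nat.cast_zero, zero_div]; positivity
  have hPM : (0 : ℝ) < Fintype.card (PMatch n) := by exact_mod_cast Fintype.card_pos_iff.2 ⟨q₀.2⟩
  set K : ℝ := ((univ.filter fun U : OddSet n => U.1.card = t ∧ cc U q₀.2 = c).card : ℝ) with hK
  have hQcard := card_Qset_eq_colCount_mul (n := n) t c q₀.2
  have hKpos : 0 < K := by
    rw [hK]; exact_mod_cast card_pos.2 ⟨q₀.1, by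
      rw [mem_filter]; exact ⟨mem_univ _, (mem_Qset_iff.1 hq₀)⟩⟩
  have hnum : ((((A ×ˢ B) ∩ Qset n t c).card : ℕ) : ℝ) ≤ K * B.card := by
    have h1 : ((A ×ˢ B) ∩ Qset n t c).card ≤ ((Qset n t c).filter fun q => q.2 ∈ B).card := by
      refine card_le_card fun q hq => ?_
      rw [mem_inter, mem_product] at hq
      exact mem_filter.2 ⟨hq.2, hq.1.2⟩
    have h2 : ((((Qset n t c).filter fun q => q.2 ∈ B).card : ℕ) : ℝ) = K * B.card := by
      rw [card_filter, Nat.cast_sum]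
      have := sum_Qset_snd (n := n) t c (fun M => if M ∈ B then (1 : ℝ) else 0) q₀.2
      push_cast
      rw [this, hK, sum_boole]
      simp
    calc ((((A ×ˢ B) ∩ Qset n t c).card : ℕ) : ℝ) ≤ (((Qset n t c).filter fun q => q.2 ∈ B).card : ℕ) := by exact_mod_cast h1
      _ = K * B.card := h2
  rw [mu, hQcard, div_le_div_iff₀ (by positivity) hPM]
  nlinarith

/-- **Uniform row marginal**: `μ_c(A × B) ≤ |{U ∈ A : |U| = t}| / #(t-cuts)`. [cite: Rothvoss2017, §2 (PDF p. 6)] -/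
theorem mu_le_row (t c : ℕ) (A : Finset (OddSet n)) (B : Finset (PMatch n)) :
    mu n t c A B ≤ ((A.filter fun U => U.1.card = t).card : ℝ) / (univ.filter fun U : OddSet n => U.1.card = t).card := by
  classical
  rcases (Qset n t c).eq_empty_or_nonempty with hQ | ⟨q₀, hq₀⟩
  · rw [mu, hQ, inter_empty, card_empty, Nat.cast_zero, zero_div]; positivity
  have hq₀t : q₀.1.1.card = t := (mem_Qset_iff.1 hq₀).1
  have hT : (0 : ℝ) < (univ.filter fun U : OddSet n => U.1.card = t).card := by
    exact_mod_cast card_pos.2 ⟨q₀.1, by simp [hq₀t]⟩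
  set K : ℝ := ((univ.filter fun M : PMatch n => cc q₀.1 M = c).card : ℝ) with hK
  have hQcard := card_Qset_eq_rowCount_mul (n := n) t c q₀.1 hq₀t
  have hKpos : 0 < K := by
    rw [hK]; exact_mod_cast card_pos.2 ⟨q₀.2, by rw [mem_filter]; exact ⟨mem_univ _, (mem_Qset_iff.1 hq₀).2⟩⟩
  have hnum : ((((A ×ˢ B) ∩ Qset n t c).card : ℕ) : ℝ) ≤ K * (A.filter fun U => U.1.card = t).card := by
    have h1 : ((A ×ˢ B) ∩ Qset n t c).card ≤ ((Qset n t c).filter fun q => q.1 ∈ A).card := by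
      refine card_le_card fun q hq => ?_
      rw [mem_inter, mem_product] at hq
      exact mem_filter.2 ⟨hq.2, hq.1.1⟩
    have h2 : ((((Qset n t c).filter fun q => q.1 ∈ A).card : ℕ) : ℝ) = K * (A.filter fun U => U.1.card = t).card := by
      rw [card_filter, Nat.cast_sum]
      have := sum_Qset_fst (n := n) t c (fun U => if U ∈ A then (1 : ℝ) else 0) q₀.1 hq₀t
      have hset : (univ.filter fun U : OddSet n => U.1.card = t).filter (fun U => U ∈ A) = A.filter (fun U => U.1.card = t) := by
        ext U; simp [and_comm]
      push_cast
      rw [this, hK, sum_boole, hset]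
    calc ((((A ×ˢ B) ∩ Qset n t c).card : ℕ) : ℝ) ≤ (((Qset n t c).filter fun q => q.1 ∈ A).card : ℕ) := by exact_mod_cast h1
      _ = K * (A.filter fun U => U.1.card = t).card := h2
  rw [mu, hQcard, div_le_div_iff₀ (by positivity) hT]
  nlinarith

/-- **Rectangles are at most their column density**: `|Σ_{U∈A}Σ_{M∈B} W(U,M)| ≤ (Σ_{c∈C} |w_c|)·|B|/|PM_n|` (the bound used for the
Kupavskii–Zakharov remainder and for junk). [cite: Rothvoss2017, §2 (PDF p. 6)] -/
theorem abs_sum_sum_levelWeight_le_col (t : ℕ) (C : Finset ℕ) (w : ℕ → ℝ) (A : Finset (OddSet n)) (B : Finset (PMatch n)) :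
    |∑ U ∈ A, ∑ M ∈ B, levelWeight n t C w U M| ≤ (∑ c ∈ C, |w c|) * ((B.card : ℝ) / Fintype.card (PMatch n)) := by
  rw [sum_sum_levelWeight_eq_sum_mu, sum_mul]
  refine (abs_sum_le_sum_abs _ _).trans (sum_le_sum fun c _ => ?_)
  rw [abs_mul, abs_of_nonneg (mu_nonneg t c A B)]
  exact mul_le_mul_of_nonneg_left (mu_le_col t c A B) (abs_nonneg _)

/-! ### §2 Splitting a family of cuts by its pattern on the support of a core -/

/-- `Σ_{U ∈ A} g(U) = Σ_{π ⊆ V} Σ_{U ∈ A, U ∩ V = π} g(U)`. [cite: Rothvoss2017, §2 (PDF p. 6)] -/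
theorem sum_eq_sum_patterns {β : Type*} [AddCommMonoid β] (A : Finset (OddSet n)) (V : Finset (Fin n)) (g : OddSet n → β) :
    ∑ U ∈ A, g U = ∑ π ∈ V.powerset, ∑ U ∈ A.filter (fun U => U.1 ∩ V = π), g U := by
  rw [sum_fiberwise_of_maps_to (g := fun U : OddSet n => U.1 ∩ V)]
  intro U _
  exact mem_powerset.2 inter_subset_right

/-! ### §3 Crossing cells -/

/-- **Crossing cells are small.** For `n` even, an exact design `(n, t = 2c'+1, T, D, B_v, C, w)` with `4 ≤ D ≤ 2c'`, a vertex set `V`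
containing an edge `{a, b}` that CROSSES the pattern `π ⊆ V`, a family `A` of `t`-cuts and a set `B` of perfect matchings all containing `{a,b}`:
`|Σ_{U∈A, U∩V=π} Σ_{M∈B} W(U,M)| ≤ B_v·√(P_{D−4} · μ(A_π) · ν(B))` with `μ(A_π) = |A_π|/C(n,t)`, `ν(B) = |B|/|PM_n|`. [cite: Rothvoss2017, §2 (PDF p. 6)] -/
theorem abs_crossing_cell_le {c' T D : ℕ} {Bv : ℝ} {C : Finset ℕ} {w : ℕ → ℝ} (hn : Even n)
    (hdes : IsExactDesign n (2 * c' + 1) T D Bv C w) (hD : D ≤ 2 * c') (hD4 : 4 ≤ D) {V π : Finset (Fin n)} {a b : Fin n}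
    (ha : a ∈ V) (hb : b ∈ V) (hcross : Crosses π s(a, b))
    (A : Finset (OddSet n)) (hA : ∀ U ∈ A, U.1.card = 2 * c' + 1) (B : Finset (PMatch n)) (hB : ∀ M ∈ B, s(a, b) ∈ M.1) :
    |∑ U ∈ A.filter (fun U => U.1 ∩ V = π), ∑ M ∈ B, levelWeight n (2 * c' + 1) C w U M| ≤
      Bv * Real.sqrt ((∏ i ∈ range ((D - 4) / 2 + 1), ((2 * i + 1 : ℝ) / ((n : ℝ) - 2 * i))) *
        (((A.filter fun U => U.1 ∩ V = π).card : ℝ) / (n.choose (2 * c' + 1) : ℝ)) *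
          ((B.card : ℝ) / (Fintype.card (PMatch n) : ℝ))) := by
  classical
  set Aπ := A.filter (fun U => U.1 ∩ V = π) with hAπ
  set X : Finset (Finset (Fin n)) := Aπ.image Subtype.val with hXdef
  have hX : X ⊆ univ.powersetCard (2 * c' + 1) := by
    intro U hU
    obtain ⟨U', hU', rfl⟩ := mem_image.1 hU
    exact mem_powersetCard_univ.2 (hA U' (mem_filter.1 hU').1)
  have hXcross : ∀ U ∈ X, Crosses U s(a, b) := by
    intro U hU
    obtain ⟨U', hU', rfl⟩ := mem_image.1 hU
    have hUV : U'.1 ∩ V = π := (mem_filter.1 hU').2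
    have he : s(a, b) ∈ V.sym2 := by simp [ha, hb]
    rw [crosses_iff_crosses_inter he, hUV]
    exact hcross
  have key := crossingPin_value_le hn hdes hD hD4 a b X hX hXcross B hB
  have hcard : (X.card : ℝ) = Aπ.card := by rw [hXdef, card_image_of_injective _ Subtype.val_injective]
  rw [hcard] at key
  -- the crossing-pin sum is the cell value
  have hsum : ∑ U : OddSet n, ∑ M ∈ B, levelWeight n (2 * c' + 1) C w U M * (if U.1 ∈ X then (1 : ℝ) else 0) =
      ∑ U ∈ Aπ, ∑ M ∈ B, levelWeight n (2 * c' + 1) C w U M := by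
    have hmem : ∀ U : OddSet n, U.1 ∈ X ↔ U ∈ Aπ := by
      intro U
      rw [hXdef, mem_image]
      constructor
      · rintro ⟨U', hU', h⟩; rwa [← Subtype.ext h]
      · intro hU; exact ⟨U, hU, rfl⟩
    rw [← sum_filter_add_sum_filter_not univ (fun U : OddSet n => U ∈ Aπ)]
    have h0 : ∑ U ∈ univ.filter (fun U : OddSet n => ¬U ∈ Aπ), ∑ M ∈ B,
        levelWeight n (2 * c' + 1) C w U M * (if U.1 ∈ X then (1 : ℝ) else 0) = 0 :=
      sum_eq_zero fun U hU => by
        have : ¬U.1 ∈ X := fun h => (mem_filter.1 hU).2 ((hmem U).1 h)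
        simp [this]
    rw [h0, add_zero, show univ.filter (fun U : OddSet n => U ∈ Aπ) = Aπ by ext U; simp]
    refine sum_congr rfl fun U hU => sum_congr rfl fun M _ => ?_
    rw [if_pos ((hmem U).2 hU), mul_one]
  rw [hsum] at key
  exact key

/-! ### §4 Non-crossing cells in the reduced instance -/

/-- **A non-crossing cell, read in the reduced instance.** For a perfect matching `S` of `V ⊆ Fin n`, a pattern `π ⊆ V` meeting NO edge of `S`
in exactly one point (`crossCount π S = 0`), `|π| ≤ t`, a family `A` of odd cuts and a set `B` of perfect matchings all containing `S`:
`Σ_{U∈A, U∩V=π} Σ_{M∈B} W(U,M) = Σ_{c∈C} w_c · (|Q''_c(t−|π|)|/|Q_c(t)|) · μ''_c(Ã × B̃)`, the measures `μ''` taken in `K_m`, `m = n − |V|`, on the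
pulled-back families `Ã = oddCellCuts A V π`, `B̃ = pmCellMatchings B V S` (lit `mu_cell_eq`). [cite: Rothvoss2017, §2 (PDF p. 6)] -/
theorem noncrossing_cell_eq {m t : ℕ} (C : Finset ℕ) (w : ℕ → ℝ) {V π : Finset (Fin n)} {S : Finset (Sym2 (Fin n))} (hS : IsPMOn V S)
    (hπ0 : crossCount π S = 0) (hπV : π ⊆ V) (hp : π.card ≤ t) (h : (univ \ V).card = m)
    (A : Finset (OddSet n)) (B : Finset (PMatch n)) (hB : ∀ M ∈ B, S ⊆ M.1) :
    ∑ U ∈ A.filter (fun U => U.1 ∩ V = π), ∑ M ∈ B, levelWeight n t C w U M =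
      ∑ c ∈ C, w c * ((((Qset m (t - π.card) c).card : ℝ) / (Qset n t c).card) *
        mu m (t - π.card) c (oddCellCuts A V π h) (pmCellMatchings B V S h)) := by
  have hπe : Even π.card := by
    have := even_card_inter_of_crossCount_eq_zero hS hπ0
    rwa [inter_eq_left.2 hπV] at this
  have hBf : B.filter (fun M => S ⊆ M.1) = B := filter_true_of_mem hB
  rw [sum_sum_levelWeight_eq_sum_mu]
  refine sum_congr rfl fun c _ => ?_
  conv_lhs => rw [← hBf]
  rw [mu_cell_eq hS hπe h A B (by rw [hπ0]; exact Nat.zero_le c) hp, hπ0, Nat.sub_zero]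

/-- **Junk bound for a non-crossing cell**: if in addition every reduced measure is `≤ β` (e.g. one of the two reduced densities is `≤ β`), then
`|Σ_{A_π × B} W| ≤ β · Σ_c |w_c| · |Q''_c|/|Q_c|`. [cite: Rothvoss2017, §2 (PDF p. 6)] -/
theorem abs_noncrossing_cell_le {m t : ℕ} (C : Finset ℕ) (w : ℕ → ℝ) {V π : Finset (Fin n)} {S : Finset (Sym2 (Fin n))} (hS : IsPMOn V S)
    (hπ0 : crossCount π S = 0) (hπV : π ⊆ V) (hp : π.card ≤ t) (h : (univ \ V).card = m)
    (A : Finset (OddSet n)) (B : Finset (PMatch n)) (hB : ∀ M ∈ B, S ⊆ M.1) {β : ℝ}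
    (hβ : ∀ c ∈ C, mu m (t - π.card) c (oddCellCuts A V π h) (pmCellMatchings B V S h) ≤ β) :
    |∑ U ∈ A.filter (fun U => U.1 ∩ V = π), ∑ M ∈ B, levelWeight n t C w U M| ≤
      β * ∑ c ∈ C, |w c| * (((Qset m (t - π.card) c).card : ℝ) / (Qset n t c).card) := by
  rw [noncrossing_cell_eq C w hS hπ0 hπV hp h A B hB, mul_sum]
  refine (abs_sum_le_sum_abs _ _).trans (sum_le_sum fun c hc => ?_)
  have hr : (0 : ℝ) ≤ ((Qset m (t - π.card) c).card : ℝ) / (Qset n t c).card := by positivity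
  have hμ0 := mu_nonneg (n := m) (t - π.card) c (oddCellCuts A V π h) (pmCellMatchings B V S h)
  rw [abs_mul, abs_mul, abs_of_nonneg hr, abs_of_nonneg hμ0]
  calc |w c| * ((((Qset m (t - π.card) c).card : ℝ) / (Qset n t c).card) *
        mu m (t - π.card) c (oddCellCuts A V π h) (pmCellMatchings B V S h))
      ≤ |w c| * ((((Qset m (t - π.card) c).card : ℝ) / (Qset n t c).card) * β) :=
        mul_le_mul_of_nonneg_left (mul_le_mul_of_nonneg_left (hβ c hc) hr) (abs_nonneg _)
    _ = β * (|w c| * (((Qset m (t - π.card) c).card : ℝ) / (Qset n t c).card)) := by ring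

/-- **The cell classes of one core exhaust the star**: summed over ALL patterns `π ⊆ V`,
`Σ_π #{(U,M) ∈ Q_c(t) : U ∩ V = π, S ⊆ M} = #{U : |U|=t, cc(U,M₀)=c} · #{M : S ⊆ M}` (uniform column marginal of `Q_c`).
[cite: Rothvoss2017, §2 (PDF p. 6)] -/
theorem sum_patterns_card_cellClass_eq (t c : ℕ) (V : Finset (Fin n)) (S : Finset (Sym2 (Fin n))) (M₀ : PMatch n) :
    ∑ π ∈ V.powerset, ((((univ : Finset (OddSet n)).filter fun U => U.1 ∩ V = π) ×ˢ
        ((univ : Finset (PMatch n)).filter fun M => S ⊆ M.1)) ∩ Qset n t c).card =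
      (univ.filter fun U : OddSet n => U.1.card = t ∧ cc U M₀ = c).card * (univ.filter fun M : PMatch n => S ⊆ M.1).card := by
  classical
  -- both sides count `{(U,M) ∈ Q_c : S ⊆ M}`
  have hcell : ∀ π : Finset (Fin n), ((((univ : Finset (OddSet n)).filter fun U => U.1 ∩ V = π) ×ˢ
        ((univ : Finset (PMatch n)).filter fun M => S ⊆ M.1)) ∩ Qset n t c) =
      ((Qset n t c).filter fun q => S ⊆ q.2.1).filter fun q => q.1.1 ∩ V = π := by
    intro π
    ext q
    simp only [mem_inter, mem_product, mem_filter, mem_univ, true_and]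
    tauto
  have hL : ∑ π ∈ V.powerset, ((((univ : Finset (OddSet n)).filter fun U => U.1 ∩ V = π) ×ˢ
        ((univ : Finset (PMatch n)).filter fun M => S ⊆ M.1)) ∩ Qset n t c).card =
      ((Qset n t c).filter fun q => S ⊆ q.2.1).card := by
    rw [sum_congr rfl fun π _ => by rw [hcell π]]
    exact (card_eq_sum_card_fiberwise fun q _ => mem_powerset.2 inter_subset_right).symm
  have hR : ((((Qset n t c).filter fun q => S ⊆ q.2.1).card : ℕ) : ℝ) =
      ((univ.filter fun U : OddSet n => U.1.card = t ∧ cc U M₀ = c).card : ℝ) * (univ.filter fun M : PMatch n => S ⊆ M.1).card := by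
    rw [card_filter, Nat.cast_sum]
    have := sum_Qset_snd (n := n) t c (fun M => if S ⊆ M.1 then (1 : ℝ) else 0) M₀
    push_cast
    rw [this, sum_boole]
  rw [hL]
  exact_mod_cast hR

/-- **Pattern sum of the reduced level-class ratios**: for a perfect matching `S` of `V`, `t` odd,
`Σ_{π ⊆ V, crossCount π S = 0, |π| ≤ t} |Q''_c(t − |π|)|/|Q_c(t)| ≤ |{M : S ⊆ M}|/|PM_n|` (`Q''` in `K_m`, `m = n − |V|`; the non-crossing cell classes are
among the cell classes of the star of `S`, which has the uniform column marginal). [cite: Rothvoss2017, §2 (PDF p. 6)] -/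
theorem sum_patterns_cellRatio_le {m t : ℕ} (hto : Odd t) (c : ℕ) {V : Finset (Fin n)} {S : Finset (Sym2 (Fin n))} (hS : IsPMOn V S)
    (h : (univ \ V).card = m) :
    ∑ π ∈ V.powerset.filter (fun π => crossCount π S = 0 ∧ π.card ≤ t),
        (((Qset m (t - π.card) c).card : ℝ) / (Qset n t c).card) ≤
      ((univ.filter fun M : PMatch n => S ⊆ M.1).card : ℝ) / Fintype.card (PMatch n) := by
  classical
  rcases (Qset n t c).eq_empty_or_nonempty with hQ | ⟨q₀, hq₀⟩
  · rw [hQ, card_empty, Nat.cast_zero]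
    simp only [div_zero, sum_const_zero]
    positivity
  have hPM : (0 : ℝ) < Fintype.card (PMatch n) := by exact_mod_cast Fintype.card_pos_iff.2 ⟨q₀.2⟩
  set K : ℝ := ((univ.filter fun U : OddSet n => U.1.card = t ∧ cc U q₀.2 = c).card : ℝ) with hK
  have hQcard := card_Qset_eq_colCount_mul (n := n) t c q₀.2
  have hKpos : 0 < K := by
    rw [hK]; exact_mod_cast card_pos.2 ⟨q₀.1, by rw [mem_filter]; exact ⟨mem_univ _, (mem_Qset_iff.1 hq₀)⟩⟩
  have hQpos : (0 : ℝ) < (Qset n t c).card := by rw [hQcard]; positivity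
  -- each non-crossing reduced class is a cell class of the star
  have hterm : ∀ π ∈ V.powerset.filter (fun π => crossCount π S = 0 ∧ π.card ≤ t),
      (((Qset m (t - π.card) c).card : ℝ) / (Qset n t c).card) =
        (((((univ : Finset (OddSet n)).filter fun U => U.1 ∩ V = π) ×ˢ
          ((univ : Finset (PMatch n)).filter fun M => S ⊆ M.1)) ∩ Qset n t c).card : ℝ) / (Qset n t c).card := by
    intro π hπ
    obtain ⟨hπV, hπ0, hp⟩ := mem_filter.1 hπ
    have hπV' := mem_powerset.1 hπV
    have hπe : Even π.card := by
      have := even_card_inter_of_crossCount_eq_zero hS hπ0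
      rwa [inter_eq_left.2 hπV'] at this
    rw [card_univ_cell_inter_Qset_eq hS hπV' hπe h hto (by rw [hπ0]; exact Nat.zero_le c) hp, hπ0, Nat.sub_zero]
  rw [sum_congr rfl hterm, ← sum_div, div_le_div_iff₀ hQpos hPM]
  have hall := sum_patterns_card_cellClass_eq (n := n) t c V S q₀.2
  have hsub : ∑ π ∈ V.powerset.filter (fun π => crossCount π S = 0 ∧ π.card ≤ t),
      (((((univ : Finset (OddSet n)).filter fun U => U.1 ∩ V = π) ×ˢ
          ((univ : Finset (PMatch n)).filter fun M => S ⊆ M.1)) ∩ Qset n t c).card : ℝ) ≤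
      K * (univ.filter fun M : PMatch n => S ⊆ M.1).card := by
    have : (((univ.filter fun U : OddSet n => U.1.card = t ∧ cc U q₀.2 = c).card *
        (univ.filter fun M : PMatch n => S ⊆ M.1).card : ℕ) : ℝ) = K * (univ.filter fun M : PMatch n => S ⊆ M.1).card := by
      rw [hK]; push_cast; ring
    rw [← this, ← hall, Nat.cast_sum]
    exact sum_le_sum_of_subset_of_nonneg (filter_subset _ _) fun _ _ _ => by positivity
  rw [hQcard]
  nlinarith

end Summit.PneNP.PneNP.Theorems.ChebyshevTracialDesignRungCells
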